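import Mathlib.RingTheory.Ideal.GoingUp
import HarnessLib

/-!
# PROOF-B6, §2 KEY LEMMA (algebraic core): a finite (integral) extension of a domain that admits a retraction is trivial
# (cell `bsd-stepL`, seat `bsd-stepL-tam3-p1` g16, LINE OWNER of crux 19109 `EulerHalvesAtThree`; `--supports stmt-BirchSwinnertonDyer-19109`, helper)

The one step of the written proof PROOF-B6 «THEOREM B6♮» (`HOME/tam3-p1/g16/PROOF-B6.md`, evidence on item 19109) that is NOT a citation is the
«retraction lemma» of its §2: if `R → A` is an integral (e.g. finite) ring map, `A` is a domain and there is an `R`-algebra retraction `ρ : A → R`,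
then `R → A` is an isomorphism. Applied there with `R = Ô^{sh}` of the smooth level-prime-to-`q` Shimura curve at an ordinary point and `A` the complete
local ring of Zhang's normalisation model at the canonical-subgroup branch, it shows that model is formally isomorphic to the base — smooth — at every
formal-type CM reduction. This file records the lemma as a kernel theorem (incomparability of primes in integral extensions:
`Ideal.eq_bot_of_comap_eq_bot`), so that the only non-bibliographic step of PROOF-B6 is machine-checked. HONEST FRAMING: pure commutative algebra;
nothing about curves, `Ш` or BSD is asserted; no item closes (T7). [folklore]
-/

set_option linter.dupNamespace false
set_option autoImplicit false

namespace Summit.BirchSwinnertonDyer.BirchSwinnertonDyer.Theorems.ShimuraWalk.ProofB6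

/-- **Retraction lemma (PROOF-B6 §2).** Let `R → A` be an integral extension with `A` a domain (and `R` nontrivial). If there is an `R`-algebra
homomorphism `ρ : A →ₐ[R] R` (a retraction of the structure map), then the structure map `R → A` is bijective. Proof: it is injective because
`ρ ∘ algebraMap = id`; the kernel of `ρ` is an ideal of the domain `A` lying over `⊥ ⊂ R`, hence `⊥` by incomparability
(`Ideal.eq_bot_of_comap_eq_bot`), so `ρ` is injective and `a = algebraMap (ρ a)` for every `a`. [folklore] -/
theorem algebraMap_bijective_of_algHom_retraction {R A : Type*} [CommRing R] [Nontrivial R] [CommRing A] [IsDomain A]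
    [Algebra R A] [Algebra.IsIntegral R A] (ρ : A →ₐ[R] R) : Function.Bijective (algebraMap R A) := by
  have hinj : Function.Injective (algebraMap R A) := fun a b h ↦ by
    simpa only [AlgHom.commutes, Algebra.algebraMap_self_apply] using congrArg ρ h
  refine ⟨hinj, fun a ↦ ⟨ρ a, ?_⟩⟩
  have hker : RingHom.ker ρ.toRingHom = ⊥ := by
    refine Ideal.eq_bot_of_comap_eq_bot (R := R) ?_
    refine le_bot_iff.mp fun r hr ↦ ?_
    simp only [Ideal.mem_comap, RingHom.mem_ker, AlgHom.toRingHom_eq_coe, AlgHom.coe_toRingHom,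
      AlgHom.commutes] at hr
    simpa using hr
  have hmem : a - algebraMap R A (ρ a) ∈ RingHom.ker ρ.toRingHom := by
    simp [RingHom.mem_ker]
  rw [hker, Ideal.mem_bot, sub_eq_zero] at hmem
  exact hmem.symm

/-- **Corollary (the form used in PROOF-B6 §2): the retraction itself is an isomorphism.** Under the same hypotheses `ρ` is bijective, i.e.
`A ≅ R` as `R`-algebras. [folklore] -/
theorem algHom_retraction_bijective {R A : Type*} [CommRing R] [Nontrivial R] [CommRing A] [IsDomain A]
    [Algebra R A] [Algebra.IsIntegral R A] (ρ : A →ₐ[R] R) : Function.Bijective ρ := by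
  obtain ⟨_, hsurj⟩ := algebraMap_bijective_of_algHom_retraction ρ
  refine ⟨fun a b h ↦ ?_, fun r ↦ ⟨algebraMap R A r, AlgHom.commutes ρ r⟩⟩
  obtain ⟨ra, rfl⟩ := hsurj a
  obtain ⟨rb, rfl⟩ := hsurj b
  simpa only [AlgHom.commutes, Algebra.algebraMap_self_apply] using congrArg (algebraMap R A) h

end Summit.BirchSwinnertonDyer.BirchSwinnertonDyer.Theorems.ShimuraWalk.ProofB6

namespace Summit.BirchSwinnertonDyer.BirchSwinnertonDyer.Theorems.ShimuraWalk.ProofB6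

/-- **Sign lemma (PROOF-B6 §7).** Let `M` be a torsion-free abelian group «of rank ≤ 1» (any two elements are ℤ-linearly dependent) and `f` an
additive endomorphism with `f ∘ f = id`. Then `f = id` or `f = −id`. In PROOF-B6 this is applied to `M = Hom(J, E)` (free of rank one by
Jacquet–Langlands and multiplicity one) and `f = (· ∘ (w_q)_*)` for the Atkin–Lehner involution `w_q`, giving `π ∘ (w_q)_* = ε_q·π` with `ε_q = ±1`
EXACTLY (no torsion ambiguity). Proof: for `x₀ ≠ 0`, a dependence `a•x₀ = b•f x₀` and its image under `f` give `(a² − b²)•x₀ = 0`, so `a = ±b ≠ 0` and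
`f x₀ = ±x₀`; any `y` satisfies `c•x₀ = d•y` with `d ≠ 0`, and applying `f` transports the sign. [folklore] -/
theorem addMonoidEnd_eq_id_or_eq_neg_of_involutive_of_rank_le_one {M : Type*} [AddCommGroup M] [NoZeroSMulDivisors ℤ M]
    (hrk : ∀ x y : M, ∃ a b : ℤ, (a ≠ 0 ∨ b ≠ 0) ∧ a • x = b • y) (f : M →+ M) (hf : ∀ x, f (f x) = x) :
    (∀ x, f x = x) ∨ (∀ x, f x = -x) := by
  by_cases hex : ∃ x : M, x ≠ 0
  swap
  · refine Or.inl fun x ↦ ?_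
    have hx : x = 0 := by
      by_contra hx
      exact hex ⟨x, hx⟩
    rw [hx, map_zero]
  obtain ⟨x₀, hx₀⟩ := hex
  -- Step 1: `f x₀ = x₀` or `f x₀ = -x₀`.
  obtain ⟨a, b, hab, h⟩ := hrk x₀ (f x₀)
  have h' : a • f x₀ = b • x₀ := by
    have := congrArg f h
    rwa [map_zsmul, map_zsmul, hf] at this
  have hsq : (a * a - b * b) • x₀ = 0 := by
    rw [sub_smul, mul_smul, mul_smul, h, smul_comm a b (f x₀), h', sub_self]
  have hab2 : a * a = b * b := by
    rcases smul_eq_zero.mp hsq with h0 | h0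
    · exact sub_eq_zero.mp h0
    · exact absurd h0 hx₀
  have hb : b ≠ 0 := by
    rintro rfl
    rcases hab with ha | hb
    · exact ha (by simpa using hab2)
    · exact hb rfl
  have hx₀sign : f x₀ = x₀ ∨ f x₀ = -x₀ := by
    have : (a - b) * (a + b) = 0 := by ring_nf; linear_combination hab2
    rcases mul_eq_zero.mp this with h1 | h1
    · -- a = b
      have hab' : a = b := sub_eq_zero.mp h1
      left
      have : b • (f x₀ - x₀) = 0 := by rw [smul_sub, ← h, hab', sub_self]
      rcases smul_eq_zero.mp this with h0 | h0
      · exact absurd h0 hb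
      · exact sub_eq_zero.mp h0
    · -- a = -b
      have hab' : a = -b := eq_neg_of_add_eq_zero_left h1
      right
      have : b • (f x₀ + x₀) = 0 := by
        rw [smul_add, ← h, hab', neg_smul, neg_add_cancel]
      rcases smul_eq_zero.mp this with h0 | h0
      · exact absurd h0 hb
      · exact eq_neg_of_add_eq_zero_left h0
  -- Step 2: transport the sign to every `y`.
  have key : ∀ y : M, ∃ c d : ℤ, d ≠ 0 ∧ c • x₀ = d • y := by
    intro y
    obtain ⟨c, d, hcd, hy⟩ := hrk x₀ y
    refine ⟨c, d, ?_, hy⟩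
    rintro rfl
    rw [zero_smul] at hy
    rcases hcd with hc | hd
    · rcases smul_eq_zero.mp hy with h0 | h0
      · exact hc h0
      · exact hx₀ h0
    · exact hd rfl
  rcases hx₀sign with hs | hs
  · left
    intro y
    obtain ⟨c, d, hd, hy⟩ := key y
    have hfy : d • f y = d • y := by
      have := congrArg f hy
      rw [map_zsmul, map_zsmul, hs] at this
      rw [← this, hy]
    have : d • (f y - y) = 0 := by rw [smul_sub, hfy, sub_self]
    rcases smul_eq_zero.mp this with h0 | h0
    · exact absurd h0 hd
    · exact sub_eq_zero.mp h0
  · right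
    intro y
    obtain ⟨c, d, hd, hy⟩ := key y
    have hfy : d • f y = d • (-y) := by
      have := congrArg f hy
      rw [map_zsmul, map_zsmul, hs, smul_neg] at this
      rw [← this, hy, smul_neg]
    have : d • (f y - -y) = 0 := by rw [smul_sub, hfy, sub_self]
    rcases smul_eq_zero.mp this with h0 | h0
    · exact absurd h0 hd
    · exact sub_eq_zero.mp h0

end Summit.BirchSwinnertonDyer.BirchSwinnertonDyer.Theorems.ShimuraWalk.ProofB6
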